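import Mathlib
import HarnessLib
import Summits.AtomisticToContinuum.FouriersLaw.Theses.JunctionLocality
import Literature.MathematicalPhysics.KineticTheory.LangevinChainKernel
import Literature.MathematicalPhysics.KineticTheory.LangevinChainGibbs
import Literature.MathematicalPhysics.KineticTheory.InfiniteChainInvariantStates
import Literature.MathematicalPhysics.KineticTheory.QuarticRingChain

/-!
# Sketch — crux ideas for `JunctionLocality.ConductanceLowerBound` (stmt-AtomisticToContinuum-11749)

Ideator 3, round 1. Two levers; the first lemmas of each line, typed over existing declarations.

* Card `far-bath-loading-share`: contact kinetic-energy kernel `K_N(a,b;u)`, its zeroth/first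
  moments, the LOADING SHARE statement, the TRANSIT-TIME statement, the contact Kubo identity
  (support, shared with the contact cards) and the composition to the crux.
* Card `no-local-heat-potential`: local heat potentials (coboundary census) on the infinite chain
  and the ring-side Leonov/Einstein–Helfand lemma.
-/

noncomputable section

open MeasureTheory Filter Topology Set
open scoped NNReal ENNReal

namespace Summit.AtomisticToContinuum.FouriersLaw.Cruxes.ConductanceLowerBound

open Literature.MathematicalPhysics.KineticTheory.HeatConduction

/-! ## Card 1 — far-bath loading share × transit time -/

section LoadingShare

variable (P : OscillatorChain)

/-- Contact kinetic-energy kernel of the `N`-chain with BOTH Langevin baths at `T`: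
`K_N(a, b; u) = Cov_eq(p_a²(0), p_b²(u)) = ∫ (p_a² − T) · P_u(p_b² − T) dμ_T^N`
(constructed kernels `transitionKernel`, Gibbs measure `gibbsMeasure`; `E_{μ_T}[p²] = T`). -/
def contactKernel (N : ℕ) (T : ℝ) (a b : Fin N) (u : ℝ) : ℝ :=
  ∫ x, ((x.2 a) ^ 2 - T) *
      (∫ y, ((y.2 b) ^ 2 - T) ∂(P.transitionKernel N T T (Real.toNNReal u) x))
    ∂(P.gibbsMeasure N T)

/-- Cross kernel `K_RL(u) = Cov(p²_{N−1}(0), p_0²(u))` for `N = n + 2`. -/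
def crossKernel (n : ℕ) (T : ℝ) (u : ℝ) : ℝ :=
  contactKernel P (n + 2) T (Fin.last (n + 1)) 0 u

/-- Energy variance of the open chain at equilibrium, `Var_{μ_T^N}(H_N)` (= `N T² c_v^{(N)}`). -/
def energyVariance (N : ℕ) (T : ℝ) : ℝ :=
  ∫ x, (P.hamiltonian N x - ∫ y, P.hamiltonian N y ∂(P.gibbsMeasure N T)) ^ 2 ∂(P.gibbsMeasure N T)

/-- LOADING SHARE (the crux-specific residual of card 1): the far bath's calorimetric loading
`C_LR = (γ²/T²)∫₀^∞ u K_RL(u) du` is a positive FRACTION `η` of the exact budget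
`C_LR + C_RR = Var(H_N)/(2T²)` (one-third-law identity I2), eventually in `N`:
`η · Var(H_N) ≤ 2γ² ∫₀^∞ u K_RL(u) du`. Fourier phenomenology: `η → 1/3`; insulator: `η → 0`.
Equivalent exact form: `‖Dᵉ‖² − ‖Dᵒ‖² ≤ (1 − 2η)·Var(H_N)` for the reflection-odd Poisson
potential `D = (−L_N)⁻¹[γ(p̃²_{N−1} − p̃²_0)]` (momentum-even/odd parts). -/
def LoadingShare : Prop :=
  ∀ T : ℝ, 0 < T → ∃ η : ℝ, 0 < η ∧ ∀ᶠ n : ℕ in atTop,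
    η * energyVariance P (n + 2) T ≤ 2 * P.γ ^ 2 * ∫ u in Ioi (0 : ℝ), u * crossKernel P n T u

/-- TRANSIT TIME (the quantitative residual, carries all the smallness of `κ(T)`): the mean
arrival time of the contact-to-contact kernel is at most diffusive,
`∫₀^∞ u K_RL ≤ C(T)·N²·∫₀^∞ K_RL`, eventually in `N`. -/
def TransitTime : Prop :=
  ∀ T : ℝ, 0 < T → ∃ C : ℝ, ∀ᶠ n : ℕ in atTop,
    ∫ u in Ioi (0 : ℝ), u * crossKernel P n T u ≤
      C * ((n : ℝ) + 2) ^ 2 * ∫ u in Ioi (0 : ℝ), crossKernel P n T u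

/-- ENERGY VARIANCE IS EXTENSIVE (support, statics of the 1-D Gibbs chain): `Var(H_N) ≥ v·N`. -/
def EnergyVarianceExtensive : Prop :=
  ∀ T : ℝ, 0 < T → ∃ v : ℝ, 0 < v ∧ ∀ᶠ n : ℕ in atTop, v * ((n : ℝ) + 2) ≤ energyVariance P (n + 2) T

end LoadingShare

/-- CONTACT KUBO IDENTITY (support, shared with the contact cards / route TransferKernelPositivity's
`ContactIdentity`, ContactEchoWindows' `ContactKubo`): in the crux's own frame (weak-NESS uniqueness,
any steady-state family, response coefficients `D`), `D_N = (N−1)·(γ²/T²)·∫₀^∞ K_RL(u) du` for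
`N = n + 2`. -/
def ContactKubo : Prop :=
  ∀ ω₂ lam β γ : ℝ, 0 < ω₂ → 0 < lam → 0 < β → 0 < γ →
    (∀ (N : ℕ) (T_L T_R : ℝ), 0 < T_L → 0 < T_R →
      ∀ μ ν : Measure (PhaseSpace N), (pinnedChain ω₂ lam β γ).IsSteadyState N T_L T_R μ →
        (pinnedChain ω₂ lam β γ).IsSteadyState N T_L T_R ν → μ = ν) →
    ∀ μ : (N : ℕ) → ℝ → ℝ → Measure (PhaseSpace N),
      (∀ (N : ℕ) (T_L T_R : ℝ), 0 < T_L → 0 < T_R →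
        (pinnedChain ω₂ lam β γ).IsSteadyState N T_L T_R (μ N T_L T_R)) →
      ∀ T : ℝ, 0 < T → ∀ D : ℕ → ℝ,
        (∀ N : ℕ, Tendsto (fun δ : ℝ =>
            (pinnedChain ω₂ lam β γ).totalCurrent (μ N (T + δ / 2) (T - δ / 2)) / δ)
          (𝓝[≠] 0) (𝓝 (D N))) →
        ∀ n : ℕ, D (n + 2) = ((n : ℝ) + 1) * (γ ^ 2 / T ^ 2) *
          ∫ u in Ioi (0 : ℝ), crossKernel (pinnedChain ω₂ lam β γ) n T u

/-- Composition of card 1 (statement only; the proof is three lines of real analysis: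
`D_N = (N−1)(γ²/T²)∫K ≥ (N−1)(γ²/T²)(∫uK)/(C N²) ≥ (N−1)·η·Var(H)/(2T²C N²) ≥ (N−1)ηvN/(2T²CN²)`). -/
theorem conductanceLowerBound_of_loadingShare
    (hK : ContactKubo)
    (hS : ∀ ω₂ lam β γ : ℝ, 0 < ω₂ → 0 < lam → 0 < β → 0 < γ →
      LoadingShare (pinnedChain ω₂ lam β γ))
    (hT : ∀ ω₂ lam β γ : ℝ, 0 < ω₂ → 0 < lam → 0 < β → 0 < γ →
      TransitTime (pinnedChain ω₂ lam β γ))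
    (hV : ∀ ω₂ lam β γ : ℝ, 0 < ω₂ → 0 < lam → 0 < β → 0 < γ →
      EnergyVarianceExtensive (pinnedChain ω₂ lam β γ)) :
    Summit.AtomisticToContinuum.FouriersLaw.Theses.JunctionLocality.ConductanceLowerBound := by
  sorry

/-- The real-variable heart of the composition (truncation-free form): a kernel whose first moment
is at least `A` and whose first moment is at most `C·N²` times its zeroth moment has zeroth moment
at least `A/(C·N²)`. -/
theorem zeroth_moment_lower_bound {m0 m1 A C Nsq : ℝ} (hC : 0 < C) (hN : 0 < Nsq)
    (hA : A ≤ m1) (hT : m1 ≤ C * Nsq * m0) : A / (C * Nsq) ≤ m0 := by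
  rw [div_le_iff₀ (mul_pos hC hN)]
  nlinarith

/-! ## Card 2 — no local heat potential (coboundary census) -/

section HeatPotential

variable (P : OscillatorChain)

/-- Smooth LOCAL function on the infinite chain (polynomial growth allowed, unlike Bernardin's
bounded test class `IsLocalTestFunction`): `f = g ∘ (restriction to a centred box)`, `g` smooth. -/
def IsLocalSmooth (f : ChainConfig → ℝ) : Prop :=
  ∃ (R : ℕ) (g : (Fin (2 * R + 1) → ℝ × ℝ) → ℝ), ContDiff ℝ (⊤ : ℕ∞) g ∧ f = g ∘ boxRestrict R

/-- `(σf, τf)` is a LOCAL HEAT POTENTIAL for `P`: the bond energy current density is a Liouville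
coboundary modulo a lattice gradient, `j_0 = 𝒜 σf + τf − τf ∘ shift`, identically. Then on every ring
the total current is an exact coboundary of `Σ_x σf∘shift^x` (the `τ`-part telescopes): a "local
insulator" (dressed energy-polarisation `Σ x e_x − Σ σf∘shift^x` conserved). -/
def IsLocalHeatPotential (σf τf : ChainConfig → ℝ) : Prop :=
  IsLocalSmooth σf ∧ IsLocalSmooth τf ∧
    ∀ σ : ChainConfig, P.bondCurrentZ σ 0 = liouvilleZ P σf σ + τf σ - τf (shift σ)

/-- NO LOCAL HEAT POTENTIAL (the coboundary census, all ranges/degrees): the first lemma of card 2,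
claimed for `pinnedChain ω₂ lam β γ` for ALL `lam, β ≥ 0` (harmonic member included: there `j`
overlaps a conserved charge, the opposite obstruction). -/
def NoLocalHeatPotential : Prop :=
  ¬ ∃ σf τf : ChainConfig → ℝ, IsLocalHeatPotential P σf τf

end HeatPotential

/-- Census target for the conjunct's chains (and the harmonic member). -/
def PinnedChainNoLocalHeatPotential : Prop :=
  ∀ ω₂ lam β γ : ℝ, 0 < ω₂ → 0 ≤ lam → 0 ≤ β →
    NoLocalHeatPotential (pinnedChain ω₂ lam β γ)

/-- Ring-side Leonov / Einstein–Helfand lemma (pure FTC + Minkowski): if `G` is a potential for the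
ring current along a flow `Φ` (`d/dt G(Φ_t x) = J_ring(Φ_t x)`), then the time-integrated current
has `L²(ν)`-norm at most `2‖G‖_{L²}` for any finite measure `ν` invariant under each `Φ_t` —
so a local heat potential (`G = Σ_x σf∘shift^x`, `‖G‖² = O(N)` under the ring Gibbs state) forces
`Var(∫₀ᵗ J_ring)/N` to stay bounded in `t`: zero ring Green–Kubo conductivity at every `N`. -/
def RingPotentialBound : Prop :=
  ∀ (N : ℕ) (ν : Measure (PhaseSpace N)) [IsFiniteMeasure ν]
    (Φ : ℝ → PhaseSpace N → PhaseSpace N) (J G : PhaseSpace N → ℝ),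
    (∀ t, MeasurePreserving (Φ t) ν ν) →
    (∀ x t, HasDerivAt (fun s => G (Φ s x)) (J (Φ t x)) t) →
    MemLp G 2 ν →
    ∀ t : ℝ, 0 ≤ t →
      ∫ x, (∫ s in (0 : ℝ)..t, J (Φ s x)) ^ 2 ∂ν ≤ 4 * ∫ x, (G x) ^ 2 ∂ν

end Summit.AtomisticToContinuum.FouriersLaw.Cruxes.ConductanceLowerBound
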